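import Summits.QuantumFields.BalabanUV.Beta.CombMixedT2EvenStoreyRec
import Summits.QuantumFields.BalabanUV.Beta.CompositeMixedTableGraded
import Summits.QuantumFields.BalabanUV.Beta.SymAveragingWardRootedStencils

/-!
# `BalabanUV.Beta.CombMixedT2EvenGradedLetters` — binder row D1 ∕ (C1), PART 78a: **THE LETTERS OF THE GRADED KERNEL's WARD ROW** — (W-vh)_m: the `m`-fold composite MIXED VERTEX read
# against a finest pure gauge in its BACKGROUND bond is `(λ(R_m u) − λ(x_f)) · compLinKer_m(f;(κ,u))`, `R_m u = Lc^m•u + Σ_{k<m} Lc^k•ρ_c` the block ROOT (an1's (0.4)-SYM bricks at the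
# centred root, every depth); and the EVEN HALF of (F0)'s graded composite mixed kernel at depth `m+1` is `even(S1) + 2·(S2 + S2ˢʷᵃᵖ) + ℓ∘even(compMixKerG m)` — the symmetric
# cross pairing SURVIVES (for F6c's `compMixKer` it cancels, PART 32)

WHY (journal [AN2-G81-ONLINE] J-NOTE-26 §1; memo `HOME/b2b-balaban-beta-an2/gen81/J26-GRADED-K2B.md`).  (F0) `CompositeMixedTableGraded` (p735020) typed the object Engine C's locator
says v10's second-order Ward row `a2` is inhabited by (A2-LOCATE.md 547291ba LINE 1: the cross words with the graded sign, `cM₂ 0 = 27`).  Its finest pure-gauge row in the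
background bond — (K2b) for the graded table, PART 78b `CombMixedT2EvenGradedRec` — needs ONE letter the tree did not have: the gauge row of the CROSS WORD, i.e. of the lower
composite mixed vertex `compVHKer ℓ 𝓋 Lc m` in its background slot.  This file supplies it ((W-vh)₁ = an1's `SymAveragingWardRootedStencils.symVhKerAt_div_right` — contact at the
ROOT minus contact at the fluctuation bond's base — summed by parts; (W-vh)_m by induction over F3's top peel `compVHKer_succ` with PART 32's (W-lin)_m on the transported background
leg: the two `λ(R_m b.2)` CANCEL), together with the even half of the graded kernel (PART 32's parity letters: `even_S23_eq_zero` turns `(S2 − S3) + (S2 − S3)ˢʷᵃᵖ` into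
`2·(S2 + S2ˢʷᵃᵖ)`, `even_S4_eq_zero` kills the `𝓋`-word) and its support letter in the background bond.

WHAT (`d = 3`, centred root `ρ_c = ctr 4 Lc`, bricks `ℓ 𝓋 𝒽 𝓉 = symLinKerAt ∕ symVhKerAt ∕ symHessKerAt ∕ symMixKerAt (ctr 4 Lc) Lc` constant in the level; [folklore] finite re-indexing,
summation by parts and one induction BY NAME; no `def`, no `def … : Prop`, nothing cited, 0 sorry):
§0 `compMixKerG_eq_zero_bg` (brick-generic support of (F0)'s graded kernel in the background bond — F6c's `compMixKer_eq_zero_bg` verbatim for the graded recursion);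
§1 `tsum_sum_grad_mul_symVhKerAt_right` ((W-vh)₁, tsum form; GAN24 `tsum_sum_dz_mul_eq ∕ tsum_mul_ite_sub_ite_mul`), `sum_offs_grad_mul_symVhKerAt_right` (window form, arbitrary level
function), **`tsum_sum_grad_mul_compVHKer`** ((W-vh)_m, every depth);
§2 **`compMixKerG_succ_even_eq`** (road «FP» `CompositeMixedEvenHalf.cross₃_eq_neg_cross₂_swap` (p734339) is the brick-generic termwise form of the parity letter used).
WHAT THIS IS NOT: not the Ward row itself (PART 78b); not the torus periodisation; not v11's `a2` nor its display (the road's, co-signed design [AN2-G80-RCPT-10]); nothing of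
Bałaban's asserted, valued or discharged (OUR chain rule for OUR transcription — ABSOLUTE RULE); 0 estimates; 0∕4 row-D1 binders (hW, hR, D1Tel, D1Rep); ROOT M‴ p325680 ∕ P5c ∕
D6 untouched; NOT (C1), NOT (T-ID), NOT D1, NEVER «G-an2-4 closed», NOT BetaPertH, NOT continuum, NOT Clay.

HONEST DEPENDENCY (page 1, mandatory): continuum YM on T⁴ ⇐ BetaPertH ∧ nine spine estimates (0/9 proved); BetaPertH ⇐ (D1) ∧ (D4) ∧ CAP+tail;
G-an2-4 gates asym, D1 and NE2/3/4.  HONEST FRAMING (cell contract, verbatim): «discharging `BetaPertH` makes Bałaban's UV stability UNCONDITIONAL —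
a real constructive-QFT result; it is NOT the continuum limit and NOT the Clay problem.»  ABSOLUTE RULE (cell charter, verbatim): «No internally-minted
statement may enter as a cited fact. Every hypothesis is either kernel-proved in this package or a verbatim quotation of a PUBLISHED theorem with page
reference. The manuscript(s) under audit are NOT citable for their own disputed steps — they are the thing under adjudication; programme-internal
(2001/route/tribunal) claims are never citable.»  Row D1 ∕ (C1) OWNER an2 (b2b-balaban-beta-an2) gen 81, 2026-08-29.  §1 shaped on PART 32 §1 (same induction, one brick over).
No existing file touched.
-/

noncomputable section

open scoped BigOperators

namespace Summit.QuantumFields.BalabanUV.Beta.CombMixedT2EvenGradedLetters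

open Finset
open Literature.MathematicalPhysics.QuantumFieldTheory
open Literature.MathematicalPhysics.QuantumFieldTheory.Balaban1983to89
open Literature.MathematicalPhysics.QuantumFieldTheory.Balaban1983to89.Beta
open AffineAveraging (Site box toSite unitVec dz)
open AveragingContoursRooted (ctr ctrOff ctrOff_mem_box)
open AveragingHessianKernels (Bond Near)
open Summit.QuantumFields.BalabanUV.Beta.AxialDressingRooted (one_le_of_neZero)
open Summit.QuantumFields.BalabanUV.Beta.SymAveragingHessianCounts (symLinKerAt symVhKerAt symHessKerAt symHessKerAt_swap symLinKerAt_eq_zero symVhKerAt_eq_zero_right)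
open Summit.QuantumFields.BalabanUV.Beta.SymAveragingMixedJetTables (symMixKerAt)
open Summit.QuantumFields.BalabanUV.Beta.SymAveragingWardRootedStencils (symVhKerAt_div_right)
open Summit.QuantumFields.BalabanUV.Beta.CompositeVertexKernelRec (offs winF wid compLinKer compVHKer compLinKer_succ compLinKer_zero compVHKer_zero compVHKer_succ
  compLinKer_eq_zero compVHKer_eq_zero_right near_iff_exists_offs mem_winF_succ_of_offs)
open Summit.QuantumFields.BalabanUV.Beta.CompositeMixedTableGraded (compMixKerG compMixKerG_zero compMixKerG_succ)
open Summit.QuantumFields.BalabanUV.Beta.GAN24.BorderGaugeLegContact (tsum_sum_dz_mul_eq tsum_mul_ite_sub_ite_mul)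
open Summit.QuantumFields.BalabanUV.Beta.CombMixedT2EvenStoreyTwoLetters (tsum_eq_sum_offs sum4_swap sum4_eq_zero_of_add4 sum6_push2)
open Summit.QuantumFields.BalabanUV.Beta.CombMixedT2EvenStoreyTwo (tsum_sum_grad_mul_symLinKerAt)
open Summit.QuantumFields.BalabanUV.Beta.CombMixedT2EvenStoreyRec (tsum_sum_grad_mul_compLinKer sum_offs_grad_mul_symMixKerAt_even even_S23_eq_zero even_S4_eq_zero)

/-! ## §0 Support of the graded kernel in the background bond (brick-generic) -/

section Support

variable {d : ℕ} {ℓ : ℕ → Fin (d + 1) → Site (d + 1) → Bond (d + 1) → ℝ}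
  {𝓋 𝒽 : ℕ → Fin (d + 1) → Site (d + 1) → Bond (d + 1) → Bond (d + 1) → ℝ}
  {𝓉 : ℕ → Fin (d + 1) → Site (d + 1) → Bond (d + 1) → Bond (d + 1) → Bond (d + 1) → ℝ} {L : ℕ}

/-- [folklore] SUPPORT OF THE GRADED COMPOSITE MIXED KERNEL IN THE BACKGROUND BOND: zero unless the finest background bond is in the depth-`m` window of the
level-`m` bond (F6c's `compMixKer_eq_zero_bg` verbatim for (F0)'s recursion — the sign of the third summand is immaterial). -/
theorem compMixKerG_eq_zero_bg : ∀ (m : ℕ) {μ : Fin (d + 1)} {y : Site (d + 1)} {g : Bond (d + 1)} (f f' : Bond (d + 1)),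
    g.2 ∉ winF (L ^ m) (wid L m) y → compMixKerG ℓ 𝓋 𝒽 𝓉 L m μ y g f f' = 0
  | 0, _, _, _, _, _, _ => rfl
  | m + 1, μ, y, g, f, f', h => by
      rw [compMixKerG_succ]
      have A : ∀ κ, ∀ e ∈ offs L, compLinKer ℓ L m g (κ, (L : ℤ) • y + e) = 0 :=
        fun κ e he => compLinKer_eq_zero m fun hn => h (mem_winF_succ_of_offs he hn)
      have B : ∀ κ, ∀ e ∈ offs L, compVHKer ℓ 𝓋 L m κ ((L : ℤ) • y + e) f g = 0 :=
        fun κ e he => compVHKer_eq_zero_right m f fun hn => h (mem_winF_succ_of_offs he hn)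
      have B' : ∀ κ, ∀ e ∈ offs L, compVHKer ℓ 𝓋 L m κ ((L : ℤ) • y + e) f' g = 0 :=
        fun κ e he => compVHKer_eq_zero_right m f' fun hn => h (mem_winF_succ_of_offs he hn)
      have C : ∀ κ, ∀ e ∈ offs L, compMixKerG ℓ 𝓋 𝒽 𝓉 L m κ ((L : ℤ) • y + e) g f f' = 0 :=
        fun κ e he => compMixKerG_eq_zero_bg m f f' fun hn => h (mem_winF_succ_of_offs he hn)
      have S1 : (∑ κ : Fin (d + 1), ∑ e ∈ offs L, ∑ κ₁ : Fin (d + 1), ∑ e₁ ∈ offs L, ∑ κ₂ : Fin (d + 1), ∑ e₂ ∈ offs L,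
          𝓉 m μ y (κ, (L : ℤ) • y + e) (κ₁, (L : ℤ) • y + e₁) (κ₂, (L : ℤ) • y + e₂)
            * compLinKer ℓ L m g (κ, (L : ℤ) • y + e) * compLinKer ℓ L m f (κ₁, (L : ℤ) • y + e₁)
            * compLinKer ℓ L m f' (κ₂, (L : ℤ) • y + e₂)) = 0 :=
        Finset.sum_eq_zero fun κ _ => Finset.sum_eq_zero fun e he => Finset.sum_eq_zero fun κ₁ _ => Finset.sum_eq_zero fun e₁ _ =>
          Finset.sum_eq_zero fun κ₂ _ => Finset.sum_eq_zero fun e₂ _ => by rw [A κ e he, mul_zero, zero_mul, zero_mul]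
      have S2 : (∑ κ₁ : Fin (d + 1), ∑ e₁ ∈ offs L, ∑ κ₂ : Fin (d + 1), ∑ e₂ ∈ offs L,
          𝒽 m μ y (κ₁, (L : ℤ) • y + e₁) (κ₂, (L : ℤ) • y + e₂)
            * compVHKer ℓ 𝓋 L m κ₁ ((L : ℤ) • y + e₁) f g * compLinKer ℓ L m f' (κ₂, (L : ℤ) • y + e₂)) = 0 :=
        Finset.sum_eq_zero fun κ₁ _ => Finset.sum_eq_zero fun e₁ he₁ => Finset.sum_eq_zero fun κ₂ _ => Finset.sum_eq_zero fun e₂ _ => by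
          rw [B κ₁ e₁ he₁, mul_zero, zero_mul]
      have S3 : (∑ κ₁ : Fin (d + 1), ∑ e₁ ∈ offs L, ∑ κ₂ : Fin (d + 1), ∑ e₂ ∈ offs L,
          𝒽 m μ y (κ₁, (L : ℤ) • y + e₁) (κ₂, (L : ℤ) • y + e₂)
            * compLinKer ℓ L m f (κ₁, (L : ℤ) • y + e₁) * compVHKer ℓ 𝓋 L m κ₂ ((L : ℤ) • y + e₂) f' g) = 0 :=
        Finset.sum_eq_zero fun κ₁ _ => Finset.sum_eq_zero fun e₁ _ => Finset.sum_eq_zero fun κ₂ _ => Finset.sum_eq_zero fun e₂ he₂ => by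
          rw [B' κ₂ e₂ he₂, mul_zero]
      have S4 : (∑ κ₁ : Fin (d + 1), ∑ e₁ ∈ offs L, ∑ κ : Fin (d + 1), ∑ e ∈ offs L,
          𝓋 m μ y (κ₁, (L : ℤ) • y + e₁) (κ, (L : ℤ) • y + e)
            * compVHKer ℓ 𝒽 L m κ₁ ((L : ℤ) • y + e₁) f f' * compLinKer ℓ L m g (κ, (L : ℤ) • y + e)) = 0 :=
        Finset.sum_eq_zero fun κ₁ _ => Finset.sum_eq_zero fun e₁ _ => Finset.sum_eq_zero fun κ _ => Finset.sum_eq_zero fun e he => by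
          rw [A κ e he, mul_zero]
      have S5 : (∑ κ : Fin (d + 1), ∑ e ∈ offs L, ℓ m μ y (κ, (L : ℤ) • y + e) * compMixKerG ℓ 𝓋 𝒽 𝓉 L m κ ((L : ℤ) • y + e) g f f') = 0 :=
        Finset.sum_eq_zero fun κ _ => Finset.sum_eq_zero fun e he => by rw [C κ e he, mul_zero]
      rw [S1, S2, S3, S4, S5]; ring

end Support

variable {Lc : ℕ} [NeZero Lc]

/-! ## §1 (W-vh)₁ and (W-vh)_m: the composite mixed vertex against a finest pure gauge in its background bond -/

/-- [folklore] **(W-vh)₁ — an1's SYM MIXED VERTEX BRICK AGAINST A FINEST PURE GAUGE IN ITS BACKGROUND BOND** (`symVhKerAt_div_right` — contact at the ROOT `Lc•y + ρ_c` minus contact at the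
fluctuation bond's base — summed by parts): `Σ'_x Σ_α (λ(x+e_α) − λ x)·𝓋(μ,y;f,(α,x)) = (λ(Lc•y + ρ_c) − λ(f.2))·ℓ(μ,y;f)`. -/
theorem tsum_sum_grad_mul_symVhKerAt_right (lam : Site (3 + 1) → ℝ) (μ : Fin (3 + 1)) (y : Site (3 + 1)) (f : Bond (3 + 1)) :
    ∑' x : Site (3 + 1), ∑ α : Fin (3 + 1), (lam (x + unitVec α) - lam x) * symVhKerAt (ctr 4 Lc) Lc μ y f (α, x)
      = (lam ((Lc : ℤ) • y + ctr 4 Lc) - lam f.2) * symLinKerAt (ctr 4 Lc) Lc μ y f := by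
  have hLc : 1 ≤ Lc := one_le_of_neZero Lc
  set F : Fin (3 + 1) → Site (3 + 1) → ℝ := fun α x => symVhKerAt (ctr 4 Lc) Lc μ y f (α, x) with hF
  have hFsupp : ∀ α x, ¬ Near Lc y x → F α x = 0 := fun α x hx => by
    simp only [hF, show ctr 4 Lc = toSite (ctrOff 4 Lc) from rfl]
    exact symVhKerAt_eq_zero_right (ctrOff_mem_box hLc) f (f' := (α, x)) hx
  have hFsum : ∀ α (g : Site (3 + 1) → ℝ), Summable fun x => g x * F α x := fun α g =>
    summable_of_ne_finset_zero (s := (offs Lc).image fun e => (Lc : ℤ) • y + e) fun x hx => by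
      rw [hFsupp α x (fun hn => hx ?_), mul_zero]
      obtain ⟨e, he, rfl⟩ := near_iff_exists_offs.1 hn
      exact Finset.mem_image.2 ⟨e, he, rfl⟩
  have hparts := tsum_sum_dz_mul_eq F hFsum lam
  simp only [dz] at hparts
  rw [show (∑' x : Site (3 + 1), ∑ α : Fin (3 + 1), (lam (x + unitVec α) - lam x) * symVhKerAt (ctr 4 Lc) Lc μ y f (α, x))
      = ∑' x : Site (3 + 1), ∑ α : Fin (3 + 1), (lam (x + unitVec α) - lam x) * F α x from rfl, hparts]
  have hsite : ∀ z : Site (3 + 1), ∑ α : Fin (3 + 1), (F α (z - unitVec α) - F α z)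
      = ((if (Lc : ℤ) • y + ctr 4 Lc = z then (1 : ℝ) else 0) - (if f.2 = z then 1 else 0)) * symLinKerAt (ctr 4 Lc) Lc μ y f := fun z => by
    simp only [hF]
    exact symVhKerAt_div_right hLc (ctr 4 Lc) μ y f z
  simp only [hsite]
  exact tsum_mul_ite_sub_ite_mul lam ((Lc : ℤ) • y + ctr 4 Lc) f.2 (symLinKerAt (ctr 4 Lc) Lc μ y f)

/-- [folklore] (W-vh)₁ AT LEVEL `m`, window form, for an ARBITRARY function `Λ` of the level-`m` sites:
`Σ_κ Σ_{e ∈ offs} (Λ(Lc•y+e+e_κ) − Λ(Lc•y+e))·𝓋(μ,y;b,(κ,Lc•y+e)) = (Λ(Lc•y + ρ_c) − Λ(b.2))·ℓ(μ,y;b)`. -/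
theorem sum_offs_grad_mul_symVhKerAt_right (Lam : Site (3 + 1) → ℝ) (μ : Fin (3 + 1)) (y : Site (3 + 1)) (b : Bond (3 + 1)) :
    ∑ κ : Fin (3 + 1), ∑ e ∈ offs Lc,
        (Lam ((Lc : ℤ) • y + e + unitVec κ) - Lam ((Lc : ℤ) • y + e)) * symVhKerAt (ctr 4 Lc) Lc μ y b (κ, (Lc : ℤ) • y + e)
      = (Lam ((Lc : ℤ) • y + ctr 4 Lc) - Lam b.2) * symLinKerAt (ctr 4 Lc) Lc μ y b := by
  have hLc : 1 ≤ Lc := one_le_of_neZero Lc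
  have h := tsum_sum_grad_mul_symVhKerAt_right (Lc := Lc) Lam μ y b
  rw [tsum_eq_sum_offs (L := Lc) (y := y)] at h
  · rw [Finset.sum_comm]
    exact h
  · intro u hu
    refine Finset.sum_eq_zero fun κ _ => ?_
    rw [show ctr 4 Lc = toSite (ctrOff 4 Lc) from rfl, symVhKerAt_eq_zero_right (ctrOff_mem_box hLc) b (f' := (κ, u)) hu, mul_zero]

/-- [folklore] **(W-vh)_m — THE `m`-FOLD COMPOSITE MIXED VERTEX AGAINST A FINEST PURE GAUGE IN ITS BACKGROUND BOND IS THE COMPOSITE LINEAR KERNEL TIMES THE GAUGE DROP FROM THE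
BLOCK ROOT TO THE FLUCTUATION BOND's BASE**: for an1's sym bricks at the centred root, every depth `m`, level-`m` bond `(κ,u)`, finest bond `f`, function `λ`,
`Σ'_x Σ_α (λ(x+e_α) − λ x)·compVHKer ℓ 𝓋 Lc m κ u f (α,x) = (λ(R_m u) − λ(f.2))·compLinKer ℓ Lc m f (κ,u)`, `R_m u = Lc^m•u + Σ_{k<m} Lc^k•ρ_c` — induction over the top peel
`compVHKer_succ`: the `𝓋`-word's transported background leg is (W-lin)_m (PART 32) with `Λ_m := λ∘R_m`, then (W-vh)₁ at level `m`; the `ℓ`-word carries the depth-`m` row; the two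
`λ(R_m b.2)` cancel and `Σ_b ℓ(μ,y;b)·compLinKer_m(f;b) = compLinKer_{m+1}(f;(μ,y))`. -/
theorem tsum_sum_grad_mul_compVHKer (lam : Site (3 + 1) → ℝ) : ∀ (m : ℕ) (κ : Fin (3 + 1)) (u : Site (3 + 1)) (f : Bond (3 + 1)),
    ∑' x : Site (3 + 1), ∑ α : Fin (3 + 1), (lam (x + unitVec α) - lam x)
        * compVHKer (fun _ => symLinKerAt (ctr 4 Lc) Lc) (fun _ => symVhKerAt (ctr 4 Lc) Lc) Lc m κ u f (α, x)
      = (lam (((Lc ^ m : ℕ) : ℤ) • u + ∑ k ∈ Finset.range m, ((Lc ^ k : ℕ) : ℤ) • ctr 4 Lc) - lam f.2)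
        * compLinKer (fun _ => symLinKerAt (ctr 4 Lc) Lc) Lc m f (κ, u)
  | 0, κ, u, f => by
      simp only [compVHKer_zero, mul_zero, Finset.sum_const_zero, tsum_zero, compLinKer_zero, pow_zero, Nat.cast_one, one_smul, Finset.range_zero,
        Finset.sum_empty, add_zero]
      split_ifs with h
      · rw [← h, sub_self, zero_mul]
      · rw [mul_zero]
  | m + 1, κ, u, f => by
      have hLc : 1 ≤ Lc := one_le_of_neZero Lc
      have IH := tsum_sum_grad_mul_compVHKer lam m
      -- top peel, pointwise in the finest site: the `𝓋`-word (transported background leg innermost) and the `ℓ`-word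
      have hpt : ∀ x : Site (3 + 1), (∑ α : Fin (3 + 1), (lam (x + unitVec α) - lam x)
            * compVHKer (fun _ => symLinKerAt (ctr 4 Lc) Lc) (fun _ => symVhKerAt (ctr 4 Lc) Lc) Lc (m + 1) κ u f (α, x))
          = (∑ κ₁ : Fin (3 + 1), ∑ e₁ ∈ offs Lc, ∑ κ' : Fin (3 + 1), ∑ e' ∈ offs Lc,
              symVhKerAt (ctr 4 Lc) Lc κ u (κ₁, (Lc : ℤ) • u + e₁) (κ', (Lc : ℤ) • u + e')
                * compLinKer (fun _ => symLinKerAt (ctr 4 Lc) Lc) Lc m f (κ₁, (Lc : ℤ) • u + e₁)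
                * ∑ α : Fin (3 + 1), (lam (x + unitVec α) - lam x) * compLinKer (fun _ => symLinKerAt (ctr 4 Lc) Lc) Lc m (α, x) (κ', (Lc : ℤ) • u + e'))
            + ∑ κ₁ : Fin (3 + 1), ∑ e₁ ∈ offs Lc, symLinKerAt (ctr 4 Lc) Lc κ u (κ₁, (Lc : ℤ) • u + e₁)
                * ∑ α : Fin (3 + 1), (lam (x + unitVec α) - lam x)
                    * compVHKer (fun _ => symLinKerAt (ctr 4 Lc) Lc) (fun _ => symVhKerAt (ctr 4 Lc) Lc) Lc m κ₁ ((Lc : ℤ) • u + e₁) f (α, x) := fun x => by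
        simp only [compVHKer_succ, mul_add, Finset.sum_add_distrib, Finset.mul_sum]
        congr 1
        · exact Finset.sum_comm.trans (Finset.sum_congr rfl fun κ₁ _ => Finset.sum_comm.trans (Finset.sum_congr rfl fun e₁ _ =>
            Finset.sum_comm.trans (Finset.sum_congr rfl fun κ' _ => Finset.sum_comm.trans (Finset.sum_congr rfl fun e' _ =>
            Finset.sum_congr rfl fun α _ => by ring))))
        · exact Finset.sum_comm.trans (Finset.sum_congr rfl fun κ₁ _ => Finset.sum_comm.trans (Finset.sum_congr rfl fun e₁ _ =>
            Finset.sum_congr rfl fun α _ => by ring))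
      -- finite support in the finest site
      have hs1 : ∀ (κ₁ : Fin (3 + 1)) (e₁ : Site (3 + 1)) (κ' : Fin (3 + 1)) (e' : Site (3 + 1)), Summable fun x : Site (3 + 1) =>
          symVhKerAt (ctr 4 Lc) Lc κ u (κ₁, (Lc : ℤ) • u + e₁) (κ', (Lc : ℤ) • u + e')
            * compLinKer (fun _ => symLinKerAt (ctr 4 Lc) Lc) Lc m f (κ₁, (Lc : ℤ) • u + e₁)
            * ∑ α : Fin (3 + 1), (lam (x + unitVec α) - lam x) * compLinKer (fun _ => symLinKerAt (ctr 4 Lc) Lc) Lc m (α, x) (κ', (Lc : ℤ) • u + e') :=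
        fun κ₁ e₁ κ' e' => summable_of_ne_finset_zero (s := winF (Lc ^ m) (wid Lc m) ((Lc : ℤ) • u + e')) fun x hx => by
          rw [Finset.sum_eq_zero fun α _ => ?_, mul_zero]
          rw [compLinKer_eq_zero m (f := (α, x)) (g := (κ', (Lc : ℤ) • u + e')) hx, mul_zero]
      have hs2 : ∀ (κ₁ : Fin (3 + 1)) (e₁ : Site (3 + 1)), Summable fun x : Site (3 + 1) =>
          symLinKerAt (ctr 4 Lc) Lc κ u (κ₁, (Lc : ℤ) • u + e₁)
            * ∑ α : Fin (3 + 1), (lam (x + unitVec α) - lam x)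
                * compVHKer (fun _ => symLinKerAt (ctr 4 Lc) Lc) (fun _ => symVhKerAt (ctr 4 Lc) Lc) Lc m κ₁ ((Lc : ℤ) • u + e₁) f (α, x) :=
        fun κ₁ e₁ => summable_of_ne_finset_zero (s := winF (Lc ^ m) (wid Lc m) ((Lc : ℤ) • u + e₁)) fun x hx => by
          rw [Finset.sum_eq_zero fun α _ => ?_, mul_zero]
          rw [compVHKer_eq_zero_right m f (f' := (α, x)) hx, mul_zero]
      rw [tsum_congr hpt, Summable.tsum_add (summable_sum fun κ₁ _ => summable_sum fun e₁ _ => summable_sum fun κ' _ => summable_sum fun e' _ => hs1 κ₁ e₁ κ' e')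
        (summable_sum fun κ₁ _ => summable_sum fun e₁ _ => hs2 κ₁ e₁),
        Summable.tsum_finsetSum (fun κ₁ _ => summable_sum fun e₁ _ => summable_sum fun κ' _ => summable_sum fun e' _ => hs1 κ₁ e₁ κ' e'),
        Summable.tsum_finsetSum (fun κ₁ _ => summable_sum fun e₁ _ => hs2 κ₁ e₁)]
      simp only [Summable.tsum_finsetSum (fun e₁ (_ : e₁ ∈ offs Lc) => summable_sum fun κ' _ => summable_sum fun e' _ => hs1 _ e₁ κ' e'),
        Summable.tsum_finsetSum (fun κ' _ => summable_sum fun e' (_ : e' ∈ offs Lc) => hs1 _ _ κ' e'),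
        Summable.tsum_finsetSum (fun e' (_ : e' ∈ offs Lc) => hs1 _ _ _ e'),
        Summable.tsum_finsetSum (fun e₁ (_ : e₁ ∈ offs Lc) => hs2 _ e₁), tsum_mul_left, IH, tsum_sum_grad_mul_compLinKer]
      -- (W-vh)₁ at level `m` with `Λ_m := λ ∘ R_m`, per window bond `b₁ = (κ₁, Lc•u + e₁)`
      have hA := fun (κ₁ : Fin (3 + 1)) (e₁ : Site (3 + 1)) => sum_offs_grad_mul_symVhKerAt_right (Lc := Lc)
        (fun v => lam (((Lc ^ m : ℕ) : ℤ) • v + ∑ k ∈ Finset.range m, ((Lc ^ k : ℕ) : ℤ) • ctr 4 Lc)) κ u (κ₁, (Lc : ℤ) • u + e₁)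
      have e1 : ∀ v : Site (3 + 1), ((Lc ^ m : ℕ) : ℤ) • ((Lc : ℤ) • v + ctr 4 Lc) + ∑ k ∈ Finset.range m, ((Lc ^ k : ℕ) : ℤ) • ctr 4 Lc
          = ((Lc ^ (m + 1) : ℕ) : ℤ) • v + ∑ k ∈ Finset.range (m + 1), ((Lc ^ k : ℕ) : ℤ) • ctr 4 Lc := fun v => by
        rw [Finset.sum_range_succ, smul_add, pow_succ, Nat.cast_mul, mul_smul, ← add_assoc, add_right_comm]
      have hinner : ∀ (κ₁ : Fin (3 + 1)) (e₁ : Site (3 + 1)),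
          (∑ κ' : Fin (3 + 1), ∑ e' ∈ offs Lc,
              symVhKerAt (ctr 4 Lc) Lc κ u (κ₁, (Lc : ℤ) • u + e₁) (κ', (Lc : ℤ) • u + e')
                * compLinKer (fun _ => symLinKerAt (ctr 4 Lc) Lc) Lc m f (κ₁, (Lc : ℤ) • u + e₁)
                * (lam (((Lc ^ m : ℕ) : ℤ) • ((Lc : ℤ) • u + e' + unitVec κ') + ∑ k ∈ Finset.range m, ((Lc ^ k : ℕ) : ℤ) • ctr 4 Lc)
                    - lam (((Lc ^ m : ℕ) : ℤ) • ((Lc : ℤ) • u + e') + ∑ k ∈ Finset.range m, ((Lc ^ k : ℕ) : ℤ) • ctr 4 Lc)))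
            = (lam (((Lc ^ m : ℕ) : ℤ) • ((Lc : ℤ) • u + ctr 4 Lc) + ∑ k ∈ Finset.range m, ((Lc ^ k : ℕ) : ℤ) • ctr 4 Lc)
                - lam (((Lc ^ m : ℕ) : ℤ) • ((Lc : ℤ) • u + e₁) + ∑ k ∈ Finset.range m, ((Lc ^ k : ℕ) : ℤ) • ctr 4 Lc))
              * symLinKerAt (ctr 4 Lc) Lc κ u (κ₁, (Lc : ℤ) • u + e₁)
              * compLinKer (fun _ => symLinKerAt (ctr 4 Lc) Lc) Lc m f (κ₁, (Lc : ℤ) • u + e₁) := fun κ₁ e₁ => by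
        have h := hA κ₁ e₁
        beta_reduce at h
        rw [← h, Finset.sum_mul]
        refine Finset.sum_congr rfl fun κ' _ => ?_
        rw [Finset.sum_mul]
        refine Finset.sum_congr rfl fun e' _ => ?_
        ring
      rw [Finset.sum_congr rfl fun κ₁ _ => Finset.sum_congr rfl fun e₁ _ => hinner κ₁ e₁]
      simp only [compLinKer_succ]
      rw [← e1, ← Finset.sum_add_distrib, Finset.mul_sum]
      refine Finset.sum_congr rfl fun κ₁ _ => ?_
      rw [← Finset.sum_add_distrib, Finset.mul_sum]
      refine Finset.sum_congr rfl fun e₁ _ => ?_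
      ring


/-! ## §2 The even half of the graded kernel at depth `m+1` -/

omit [NeZero Lc] in
/-- [folklore] **THE EVEN HALF OF THE DEPTH-(m+1) GRADED KERNEL IS `even(S1) + 2·(S2 + S2ˢʷᵃᵖ) + ℓ∘even(compMixKerG m)`** (pointwise in the background bond `g`): `compMixKerG_succ`
with PART 32's parity letters — `even_S23_eq_zero` (`S2 + S3 + S2ˢʷᵃᵖ + S3ˢʷᵃᵖ = 0`, i.e. `S3 = −S2ˢʷᵃᵖ` summed: road «FP» `CompositeMixedEvenHalf.cross₃_eq_neg_cross₂_swap` is the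
brick-generic termwise form) turns `(S2 − S3) + (S2 − S3)ˢʷᵃᵖ` into `2·(S2 + S2ˢʷᵃᵖ)` — the graded-SYMMETRIC cross pairing SURVIVES the even half — and `even_S4_eq_zero` kills the
`𝓋`-word; the swapped S1 re-indexed so that both halves carry `cL(f;b₁)·cL(f′;b₂)`. -/
theorem compMixKerG_succ_even_eq (m : ℕ) (μ : Fin (3 + 1)) (y : Site (3 + 1)) (g f f' : Bond (3 + 1)) :
    compMixKerG (fun _ => symLinKerAt (ctr 4 Lc) Lc) (fun _ => symVhKerAt (ctr 4 Lc) Lc) (fun _ => symHessKerAt (ctr 4 Lc) Lc) (fun _ => symMixKerAt (ctr 4 Lc) Lc)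
        Lc (m + 1) μ y g f f'
      + compMixKerG (fun _ => symLinKerAt (ctr 4 Lc) Lc) (fun _ => symVhKerAt (ctr 4 Lc) Lc) (fun _ => symHessKerAt (ctr 4 Lc) Lc) (fun _ => symMixKerAt (ctr 4 Lc) Lc)
        Lc (m + 1) μ y g f' f
      = (∑ κ : Fin (3 + 1), ∑ e ∈ offs Lc, ∑ κ₁ : Fin (3 + 1), ∑ e₁ ∈ offs Lc, ∑ κ₂ : Fin (3 + 1), ∑ e₂ ∈ offs Lc,
          (symMixKerAt (ctr 4 Lc) Lc μ y (κ, (Lc : ℤ) • y + e) (κ₁, (Lc : ℤ) • y + e₁) (κ₂, (Lc : ℤ) • y + e₂)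
            + symMixKerAt (ctr 4 Lc) Lc μ y (κ, (Lc : ℤ) • y + e) (κ₂, (Lc : ℤ) • y + e₂) (κ₁, (Lc : ℤ) • y + e₁))
            * compLinKer (fun _ => symLinKerAt (ctr 4 Lc) Lc) Lc m g (κ, (Lc : ℤ) • y + e)
            * compLinKer (fun _ => symLinKerAt (ctr 4 Lc) Lc) Lc m f (κ₁, (Lc : ℤ) • y + e₁)
            * compLinKer (fun _ => symLinKerAt (ctr 4 Lc) Lc) Lc m f' (κ₂, (Lc : ℤ) • y + e₂))
        + 2 * ((∑ κ₁ : Fin (3 + 1), ∑ e₁ ∈ offs Lc, ∑ κ₂ : Fin (3 + 1), ∑ e₂ ∈ offs Lc,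
            symHessKerAt (ctr 4 Lc) Lc μ y (κ₁, (Lc : ℤ) • y + e₁) (κ₂, (Lc : ℤ) • y + e₂)
              * compVHKer (fun _ => symLinKerAt (ctr 4 Lc) Lc) (fun _ => symVhKerAt (ctr 4 Lc) Lc) Lc m κ₁ ((Lc : ℤ) • y + e₁) f g
              * compLinKer (fun _ => symLinKerAt (ctr 4 Lc) Lc) Lc m f' (κ₂, (Lc : ℤ) • y + e₂))
          + (∑ κ₁ : Fin (3 + 1), ∑ e₁ ∈ offs Lc, ∑ κ₂ : Fin (3 + 1), ∑ e₂ ∈ offs Lc,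
            symHessKerAt (ctr 4 Lc) Lc μ y (κ₁, (Lc : ℤ) • y + e₁) (κ₂, (Lc : ℤ) • y + e₂)
              * compVHKer (fun _ => symLinKerAt (ctr 4 Lc) Lc) (fun _ => symVhKerAt (ctr 4 Lc) Lc) Lc m κ₁ ((Lc : ℤ) • y + e₁) f' g
              * compLinKer (fun _ => symLinKerAt (ctr 4 Lc) Lc) Lc m f (κ₂, (Lc : ℤ) • y + e₂)))
        + ∑ κ : Fin (3 + 1), ∑ e ∈ offs Lc, symLinKerAt (ctr 4 Lc) Lc μ y (κ, (Lc : ℤ) • y + e)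
            * (compMixKerG (fun _ => symLinKerAt (ctr 4 Lc) Lc) (fun _ => symVhKerAt (ctr 4 Lc) Lc) (fun _ => symHessKerAt (ctr 4 Lc) Lc)
                  (fun _ => symMixKerAt (ctr 4 Lc) Lc) Lc m κ ((Lc : ℤ) • y + e) g f f'
              + compMixKerG (fun _ => symLinKerAt (ctr 4 Lc) Lc) (fun _ => symVhKerAt (ctr 4 Lc) Lc) (fun _ => symHessKerAt (ctr 4 Lc) Lc)
                  (fun _ => symMixKerAt (ctr 4 Lc) Lc) Lc m κ ((Lc : ℤ) • y + e) g f' f) := by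
  have h23 := even_S23_eq_zero (Lc := Lc) m μ y g f f'
  have h4 := even_S4_eq_zero (Lc := Lc) m μ y g f f'
  -- re-index the swapped S1 so that the transported legs are `cL(f;b₁)·cL(f′;b₂)` in both halves
  have swap6 : (∑ κ : Fin (3 + 1), ∑ e ∈ offs Lc, ∑ κ₁ : Fin (3 + 1), ∑ e₁ ∈ offs Lc, ∑ κ₂ : Fin (3 + 1), ∑ e₂ ∈ offs Lc,
          symMixKerAt (ctr 4 Lc) Lc μ y (κ, (Lc : ℤ) • y + e) (κ₁, (Lc : ℤ) • y + e₁) (κ₂, (Lc : ℤ) • y + e₂)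
            * compLinKer (fun _ => symLinKerAt (ctr 4 Lc) Lc) Lc m g (κ, (Lc : ℤ) • y + e)
            * compLinKer (fun _ => symLinKerAt (ctr 4 Lc) Lc) Lc m f' (κ₁, (Lc : ℤ) • y + e₁)
            * compLinKer (fun _ => symLinKerAt (ctr 4 Lc) Lc) Lc m f (κ₂, (Lc : ℤ) • y + e₂))
      = ∑ κ : Fin (3 + 1), ∑ e ∈ offs Lc, ∑ κ₁ : Fin (3 + 1), ∑ e₁ ∈ offs Lc, ∑ κ₂ : Fin (3 + 1), ∑ e₂ ∈ offs Lc,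
          symMixKerAt (ctr 4 Lc) Lc μ y (κ, (Lc : ℤ) • y + e) (κ₂, (Lc : ℤ) • y + e₂) (κ₁, (Lc : ℤ) • y + e₁)
            * compLinKer (fun _ => symLinKerAt (ctr 4 Lc) Lc) Lc m g (κ, (Lc : ℤ) • y + e)
            * compLinKer (fun _ => symLinKerAt (ctr 4 Lc) Lc) Lc m f (κ₁, (Lc : ℤ) • y + e₁)
            * compLinKer (fun _ => symLinKerAt (ctr 4 Lc) Lc) Lc m f' (κ₂, (Lc : ℤ) • y + e₂) := by
    refine Finset.sum_congr rfl fun κ _ => Finset.sum_congr rfl fun e _ => ?_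
    rw [sum4_swap (fun κ₁ e₁ κ₂ e₂ => symMixKerAt (ctr 4 Lc) Lc μ y (κ, (Lc : ℤ) • y + e) (κ₁, (Lc : ℤ) • y + e₁) (κ₂, (Lc : ℤ) • y + e₂)
            * compLinKer (fun _ => symLinKerAt (ctr 4 Lc) Lc) Lc m g (κ, (Lc : ℤ) • y + e)
            * compLinKer (fun _ => symLinKerAt (ctr 4 Lc) Lc) Lc m f' (κ₁, (Lc : ℤ) • y + e₁)
            * compLinKer (fun _ => symLinKerAt (ctr 4 Lc) Lc) Lc m f (κ₂, (Lc : ℤ) • y + e₂))]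
    refine Finset.sum_congr rfl fun κ₁ _ => Finset.sum_congr rfl fun e₁ _ => Finset.sum_congr rfl fun κ₂ _ => Finset.sum_congr rfl fun e₂ _ => ?_
    ring
  rw [compMixKerG_succ, compMixKerG_succ, swap6]
  simp only [add_mul, mul_add, Finset.sum_add_distrib]
  linear_combination h4 - h23

end Summit.QuantumFields.BalabanUV.Beta.CombMixedT2EvenGradedLetters

end
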